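import Mathlib.Algebra.BigOperators.Ring.Finset
import Mathlib.Analysis.SpecialFunctions.Pow.Real
import Literature.Computability.AlgebraicComplexity.BorderRankCW
import Literature.Computability.AlgebraicComplexity.TensorRestrictionRank
import Literature.Barriers.MatrixMultiplication.IrreversibilityBarrierProofs

/-!
# Explicit subrank lower bounds for Kronecker powers of the small Coppersmith–Winograd tensor

The "from below" half of the door `R̃(T_{cw,2}) = 3 ⇒ ω = 2`: `ω = 2` via `T_{cw,2}` requires
`T_{cw,2}` to be asymptotically a unit tensor `⟨3⟩` from BOTH sides, i.e. `Q̃(T_{cw,2}) = 3 = R̃(T_{cw,2})`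
(Christandl–Vrana–Zuiddam 2021, Thm. 9: `ω`-bounds through `t` are `≥ 2 · log R̃(t) / log Q̃(t)`).
This file makes the subrank side explicit at small Kronecker powers by ZEROING-OUT certificates
(induced matchings / free diagonals in the support, checked by `decide`):

* `Q(T_{cw,2}) ≥ 2`       (`two_le_subrank_cwTensor_two`),
* `Q(T_{cw,2}^{⊠2}) ≥ 6`   (`six_le_subrank_kroneckerPow_cwTensor_two_two`): inside the `9 × 9 × 9`
  tensor `T_{cw,2}^{⊠2}` the coordinate blocks `X = {00,02,12,20,21,22}`, `Y = {11,10,02,01,20,22}`,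
  `Z = {11,12,10,21,01,00}` cut out exactly a diagonal of size `6` (found and proved maximal among
  zeroing-out diagonals by exhaustive search, job `j055520`; maximality is not formalised),

and the general certificate lemma `tensorRestrictsTo_unitTensor_of_cwTwoCert` (any family of index
words on which the support of `T_{cw,2}^{⊠N}` induces a perfect matching gives `T_{cw,2}^{⊠N} ≥ ⟨s⟩`).
Hence `Q̃(T_{cw,2}) ≥ √6 ≈ 2.449` from the square alone (`sqrt_six_le_…` below, stated as
`6 ≤ Q(T^{⊠2})`-consequence on the defining supremum). The true value is `Q̃(T_{cw,2}) = 3`: over `ℂ`,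
`T_{cw,2}` is isomorphic to the `S₃`-pattern tensor `∑_{σ ∈ S₃} e_{σ(1)} ⊗ e_{σ(2)} ⊗ e_{σ(3)}`
(`SoloInformedCwTwoPattern.lean`), whose support is tight (`σ(1)+σ(2)+σ(3) = 6`) and free with uniform
marginals, so Strassen's construction for tight supports (Strassen 1991, §6; Christandl–Vrana–Zuiddam
2023, §4) gives `Q̃ = 3`; that statement is recorded informally only (no vendored fact is used here).

All statements hold over an arbitrary field `K`.

[cite: ChristandlVranaZuiddam2021, Thm. 9, §2.1]
[cite: ConnerGesmundoLandsbergVentura2022, eq. (1)]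
-/

namespace Summit.MatrixMultiplication.MatrixMultiplication.Theorems

open Literature.Computability.AlgebraicComplexity
open Literature.Barriers.MatrixMultiplication
open scoped BigOperators

universe u

variable {K : Type u} [Field K]

/-- The support predicate of `T_{cw,2}`: `(0,j,j)`, `(j,0,j)`, `(j,j,0)` with `j ≠ 0`.
[cite: ConnerGesmundoLandsbergVentura2022, eq. (1)] -/
def cwTwoSupp (i j k : Fin 3) : Bool :=
  decide ((i = 0 ∧ j = k ∧ j ≠ 0) ∨ (j = 0 ∧ i = k ∧ i ≠ 0) ∨ (k = 0 ∧ i = j ∧ i ≠ 0))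

/-- `T_{cw,2}` is the indicator of `cwTwoSupp`. [cite: ConnerGesmundoLandsbergVentura2022, eq. (1)] -/
theorem cwTensor_two_eq_ite (i j k : Fin 3) :
    cwTensor K 2 i j k = if cwTwoSupp i j k then 1 else 0 := by
  simp only [cwTwoSupp, cwTensor_apply, decide_eq_true_eq]

/-- Entries of `T_{cw,2}^{⊠N}`: the indicator of "every coordinate triple lies in the support".
[cite: ChristandlVranaZuiddam2021, §2.1] -/
theorem kroneckerPow_cwTensor_two_eq_ite (N : ℕ) (a b c : Fin N → Fin 3) :
    kroneckerPow (cwTensor K 2) N a b c =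
      if (∀ m, cwTwoSupp (a m) (b m) (c m) = true) then 1 else 0 := by
  simp only [kroneckerPow_apply, cwTensor_two_eq_ite, Finset.prod_boole, Finset.mem_univ,
    true_implies]

/-- **Zeroing-out certificates.** If index words `f a, g b, h c` (`a, b, c < s`) are such that the
support of `T_{cw,2}^{⊠N}` meets `{f a} × {g b} × {h c}` exactly in the diagonal `a = b = c`, then
`T_{cw,2}^{⊠N} ≥ ⟨s⟩` (restriction to the coordinate blocks; Christandl–Vrana–Zuiddam 2021, §2.1:
`Q(t) = max {s | ⟨s⟩ ≤ t}`). [cite: ChristandlVranaZuiddam2021, §2.1] -/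
theorem tensorRestrictsTo_unitTensor_of_cwTwoCert {N s : ℕ} (f g h : Fin s → Fin N → Fin 3)
    (hcert : ∀ a b c : Fin s, (∀ m, cwTwoSupp (f a m) (g b m) (h c m) = true) ↔ (a = b ∧ b = c)) :
    TensorRestrictsTo (kroneckerPow (cwTensor K 2) N) (unitTensor K s) := by
  have key : unitTensor K s = fun a b c => kroneckerPow (cwTensor K 2) N (f a) (g b) (h c) := by
    funext a b c
    rw [kroneckerPow_cwTensor_two_eq_ite, unitTensor_apply]
    by_cases hd : a = b ∧ b = c
    · rw [if_pos hd, if_pos ((hcert a b c).2 hd)]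
    · rw [if_neg hd, if_neg (fun hm => hd ((hcert a b c).1 hm))]
  rw [key]
  exact tensorRestrictsTo_precomp _ _ _ _

/-- Consequence for the subrank: a certificate of size `s` gives `s ≤ Q(T_{cw,2}^{⊠N})`.
[cite: ChristandlVranaZuiddam2021, §2.1] -/
theorem le_subrank_kroneckerPow_cwTensor_two_of_cert {N s : ℕ} (f g h : Fin s → Fin N → Fin 3)
    (hcert : ∀ a b c : Fin s, (∀ m, cwTwoSupp (f a m) (g b m) (h c m) = true) ↔ (a = b ∧ b = c)) :
    s ≤ subrank K (kroneckerPow (cwTensor K 2) N) :=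
  le_subrank_of_restrictsTo (tensorRestrictsTo_unitTensor_of_cwTwoCert f g h hcert)

/-! ## `N = 1`: `Q(T_{cw,2}) ≥ 2` -/

/-- `T_{cw,2} ≥ ⟨2⟩`: the blocks `X = {0,2}`, `Y = {1,0}`, `Z = {1,2}` cut out the diagonal
`e_{011} + e_{202}`. [cite: ChristandlVranaZuiddam2021, §2.1] -/
theorem tensorRestrictsTo_cwTensor_two_unitTensor_two :
    TensorRestrictsTo (cwTensor K 2) (unitTensor K 2) := by
  have hiff : ∀ a b c : Fin 2,
      (cwTwoSupp ((![0, 2] : Fin 2 → Fin 3) a) ((![1, 0] : Fin 2 → Fin 3) b)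
        ((![1, 2] : Fin 2 → Fin 3) c) = true) ↔ (a = b ∧ b = c) := by
    decide
  have key : unitTensor K 2 = fun a b c => cwTensor K 2 ((![0, 2] : Fin 2 → Fin 3) a)
      ((![1, 0] : Fin 2 → Fin 3) b) ((![1, 2] : Fin 2 → Fin 3) c) := by
    funext a b c
    rw [cwTensor_two_eq_ite, unitTensor_apply]
    by_cases hd : a = b ∧ b = c
    · rw [if_pos hd, if_pos ((hiff a b c).2 hd)]
    · rw [if_neg hd, if_neg (fun hm => hd ((hiff a b c).1 hm))]
  rw [key]
  exact tensorRestrictsTo_precomp _ _ _ _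

/-- `Q(T_{cw,2}) ≥ 2`. [cite: ChristandlVranaZuiddam2021, §2.1] -/
theorem two_le_subrank_cwTensor_two : 2 ≤ subrank K (cwTensor K 2) :=
  le_subrank_of_restrictsTo tensorRestrictsTo_cwTensor_two_unitTensor_two

/-! ## `N = 2`: `Q(T_{cw,2}^{⊠2}) ≥ 6` -/

/-- First-leg words of the size-`6` certificate for the square. [cite: ChristandlVranaZuiddam2021, §2.1] -/
def sqCertX : Fin 6 → Fin 2 → Fin 3 := ![![0, 0], ![0, 2], ![1, 2], ![2, 0], ![2, 1], ![2, 2]]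
/-- Second-leg words of the size-`6` certificate for the square. [cite: ChristandlVranaZuiddam2021, §2.1] -/
def sqCertY : Fin 6 → Fin 2 → Fin 3 := ![![1, 1], ![1, 0], ![0, 2], ![0, 1], ![2, 0], ![2, 2]]
/-- Third-leg words of the size-`6` certificate for the square. [cite: ChristandlVranaZuiddam2021, §2.1] -/
def sqCertZ : Fin 6 → Fin 2 → Fin 3 := ![![1, 1], ![1, 2], ![1, 0], ![2, 1], ![0, 1], ![0, 0]]

/-- The size-`6` certificate is an induced perfect matching in the support of `T_{cw,2}^{⊠2}`
(`6³ · 2` coordinate checks, by `decide`). [cite: ChristandlVranaZuiddam2021, §2.1] -/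
theorem sqCert_valid : ∀ a b c : Fin 6,
    (∀ m, cwTwoSupp (sqCertX a m) (sqCertY b m) (sqCertZ c m) = true) ↔ (a = b ∧ b = c) := by
  unfold sqCertX sqCertY sqCertZ
  decide

/-- **`T_{cw,2}^{⊠2} ≥ ⟨6⟩`** by zeroing out. [cite: ChristandlVranaZuiddam2021, §2.1] -/
theorem tensorRestrictsTo_kroneckerPow_cwTensor_two_two_unitTensor_six :
    TensorRestrictsTo (kroneckerPow (cwTensor K 2) 2) (unitTensor K 6) :=
  tensorRestrictsTo_unitTensor_of_cwTwoCert sqCertX sqCertY sqCertZ sqCert_valid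

/-- **`Q(T_{cw,2}^{⊠2}) ≥ 6`** (of `9`). [cite: ChristandlVranaZuiddam2021, §2.1] -/
theorem six_le_subrank_kroneckerPow_cwTensor_two_two :
    6 ≤ subrank K (kroneckerPow (cwTensor K 2) 2) :=
  le_subrank_kroneckerPow_cwTensor_two_of_cert sqCertX sqCertY sqCertZ sqCert_valid

/-! ## Consequence for the asymptotic subrank: `Q̃(T_{cw,2}) ≥ √6` -/

/-- The sequence defining `Q̃(t)` is bounded above by `|ι|` (`Q(t^{⊗(N+1)}) ≤ |ι|^{N+1}`).
[cite: ChristandlVranaZuiddam2021, §2.1] -/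
theorem bddAbove_range_subrank_rpow {ι κ μ : Type} [Fintype ι] [Fintype κ] [Fintype μ]
    (t : ι → κ → μ → K) :
    BddAbove (Set.range fun N : ℕ =>
      (subrank K (kroneckerPow t (N + 1)) : ℝ) ^ ((N : ℝ) + 1)⁻¹) := by
  refine ⟨Fintype.card ι, ?_⟩
  rintro _ ⟨N, rfl⟩
  have hpos : (0 : ℝ) < (N : ℝ) + 1 := by positivity
  have hnat := subrank_kroneckerPow_le_card_pow t (N + 1)
  have hq' : (subrank K (kroneckerPow t (N + 1)) : ℝ) ≤ (Fintype.card ι : ℝ) ^ (N + 1) := by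
    exact_mod_cast hnat
  have hexp : ((N : ℝ) + 1) = ((N + 1 : ℕ) : ℝ) := by push_cast; ring
  have hq : (subrank K (kroneckerPow t (N + 1)) : ℝ) ≤ (Fintype.card ι : ℝ) ^ ((N : ℝ) + 1) := by
    rw [hexp, Real.rpow_natCast]
    exact hq'
  show (subrank K (kroneckerPow t (N + 1)) : ℝ) ^ ((N : ℝ) + 1)⁻¹ ≤ Fintype.card ι
  calc (subrank K (kroneckerPow t (N + 1)) : ℝ) ^ ((N : ℝ) + 1)⁻¹
      ≤ ((Fintype.card ι : ℝ) ^ ((N : ℝ) + 1)) ^ ((N : ℝ) + 1)⁻¹ :=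
        Real.rpow_le_rpow (by positivity) hq (by positivity)
    _ = Fintype.card ι := by
        rw [← Real.rpow_mul (by positivity), mul_inv_cancel₀ hpos.ne', Real.rpow_one]

/-- A subrank bound at one power bounds the asymptotic subrank: `Q(t^{⊗(N+1)}) ≥ s ⇒ Q̃(t) ≥ s^{1/(N+1)}`.
[cite: ChristandlVranaZuiddam2021, §2.1] -/
theorem rpow_le_asymptoticSubrank {ι κ μ : Type} [Fintype ι] [Fintype κ] [Fintype μ]
    (t : ι → κ → μ → K) (N s : ℕ) (hs : s ≤ subrank K (kroneckerPow t (N + 1))) :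
    (s : ℝ) ^ ((N : ℝ) + 1)⁻¹ ≤ asymptoticSubrank K t := by
  unfold asymptoticSubrank
  refine le_trans ?_ (le_ciSup (bddAbove_range_subrank_rpow t) N)
  exact Real.rpow_le_rpow (by positivity) (by exact_mod_cast hs) (by positivity)

/-- **`Q̃(T_{cw,2}) ≥ 6^{1/2} = √6 ≈ 2.449`** from the square (the limit is `3`, informally: Strassen's
theorem for the tight free support of the `S₃`-model; not used). [cite: ChristandlVranaZuiddam2021, §2.1] -/
theorem rpow_six_half_le_asymptoticSubrank_cwTensor_two :
    (6 : ℝ) ^ ((1 : ℝ) + 1)⁻¹ ≤ asymptoticSubrank K (cwTensor K 2) := by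
  have h := rpow_le_asymptoticSubrank (cwTensor K 2) 1 6 six_le_subrank_kroneckerPow_cwTensor_two_two
  simpa using h

end Summit.MatrixMultiplication.MatrixMultiplication.Theorems
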